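import Mathlib
import Literature.NumberTheory.LFunctions.Zhang2022.Section8aStatements
import Literature.NumberTheory.LFunctions.Zhang2022.Section2Lemma23Inputs
import HarnessLib

/-!
# Zhang (2022) §8 p. 42: "By Proposition 2.2, we can choose a rectangle `ℜ` …" — the admissible
# rectangle of the proof of Lemma 8.1 (`Z22:§8.u003`) from Proposition 2.2, kernel-checked

Topic `Literature/NumberTheory/LFunctions/Zhang2022` (Landau–Siegel adjudication tree;
verdict-neutral). Y. Zhang, *Discrete mean estimates and the Landau–Siegel zero*,
arXiv:2211.02515v1 (2022) [Zhang2022LandauSiegel] — an unrefereed manuscript under adjudication.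
DAG node `Z22:§8.u003` [Z22 p.42, tex L2197–L2201], proof of Lemma 8.1:

> Assume `ψ ∈ Ψ₁`. By Proposition 2.2, we can choose a rectangle `ℜ` with vertices at
> `s₀ ± α + i𝓛₁^{±}` such that `𝓛₁^{±} = ±𝓛₁ + O(α)` and such that the set of zeros of `L(s,ψ)`
> inside `ℜ` is exactly `Z̃(ψ)` [= `𝒵(ψ)` of (2.14)]. Further, without loss of generality, we can
> assume that `|s − ρ| ≫ α` if `s ∈ ℜ` and `ρ` is a zero of `L(s,ψ)`.

The typed statement is the CLAIM node `Section8aStatements.Step8u003` (L2-t7, p412578/p413083):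
absolute constants `C`, `c₀ > 0` and, for all large `D` and every `ψ ∈ Ψ₁`, heights `𝓛₁⁻, 𝓛₁⁺` with
`Section8aStatements.AdmRect D x C c₀ 𝓛₁⁻ 𝓛₁⁺` — `|𝓛₁^± ∓ 𝓛₁| ≤ Cα`; the zeros of `L(s,ψ)` in the
open rectangle `|σ − ½| < α`, `2πt₀ + 𝓛₁⁻ < t < 2πt₀ + 𝓛₁⁺` are exactly `𝒵(ψ)`; every zero of
`L(s,ψ)` is at distance `≥ c₀α` from `∂ℜ`. This file PROVES it from `Skeleton.Prop22 c′` (`c′ ≥ 0`),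
with `C = 1`, `c₀ = 1/8`:

* `exists_top_height` / `exists_bottom_height` — the choice of `𝓛₁^{±}`: for a finite set of heights
  any two of which differ by more than `α/2`, a level within `α/8` of `±𝓛₁`, at distance `≥ α/8` from
  every height, with no height between it and `±𝓛₁`;
* `admRect_of_prop22_at` — at one character: the zeros of `L(s,ψ)` that come within `½ − α` of the
  thin rectangle lie in `Ω`, hence (Prop. 2.2 (i)) on the critical line — at horizontal distance `α`
  from the vertical edges — and (Prop. 2.2 (iii), via the finiteness of the `Ω`-zeros and the
  consecutive-zero lemma of `Section2Lemma23Inputs`) any two of their heights differ by more than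
  `α(1 − c′α𝓛) > α/2`;
* `step8u003_of_prop22 : 0 ≤ c′ → Skeleton.Prop22 c′ → Step8u003`.

No new definitions, no named facts; nothing here bears on Theorems 1–2 of the source or on the
cell's verdict on (8.24). Cell siegel-zhang (D-0069), cone C19 (`Ded81`), L2 DISCHARGE LEDGER #5 (R10).

## References

* Y. Zhang, arXiv:2211.02515v1 (2022), §8, proof of Lemma 8.1, p. 42 (tex L2197–L2201); §2
  Proposition 2.2 p. 7. [cite: Zhang2022LandauSiegel, §8 p. 42]
-/

noncomputable section

open Complex Real Set

namespace Literature.NumberTheory.LFunctions.Zhang2022.Section8aStatements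

open Literature.NumberTheory.LFunctions.Zhang2022 Skeleton

/-! ## Choosing the heights `𝓛₁^{±}` -/

/-- **"`𝓛₁⁺ = 𝓛₁ + O(α)` … `|s − ρ| ≫ α`"**, the choice of the top height: if the heights `H` (a
finite set) are pairwise more than `a/2` apart, there is a level `Lp` with `|Lp − ℓ| ≤ a/8`, at
distance `≥ a/8` from every height, and with no height between `ℓ` and `Lp` (a height is below `Lp`
iff it is below `ℓ`): take `Lp = a₀ + a/8` if the top height `a₀` below `ℓ` is within `a/4` of `ℓ`,
and `Lp = ℓ − a/8` otherwise. [cite: Zhang2022LandauSiegel, §8 p. 42, tex L2197–L2201] -/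
theorem exists_top_height {H : Set ℝ} (hH : H.Finite) {a : ℝ} (ℓ : ℝ) (ha : 0 < a)
    (hsep : ∀ h ∈ H, ∀ h' ∈ H, h < h' → a / 2 < h' - h) :
    ∃ Lp : ℝ, |Lp - ℓ| ≤ a / 8 ∧ (∀ h ∈ H, a / 8 ≤ |h - Lp|) ∧ ∀ h ∈ H, h < Lp ↔ h < ℓ := by
  by_cases hB : ∃ h ∈ H, h < ℓ
  · obtain ⟨h₁, hh₁, hh₁ℓ⟩ := hB
    obtain ⟨a₀, ha₀, hmax⟩ := Set.exists_max_image {h ∈ H | h < ℓ} id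
      (hH.subset (sep_subset _ _)) ⟨h₁, hh₁, hh₁ℓ⟩
    simp only [id] at hmax
    obtain ⟨ha₀H, ha₀ℓ⟩ := ha₀
    by_cases hcase : a₀ ≤ ℓ - a / 4
    · refine ⟨ℓ - a / 8, by rw [abs_le]; constructor <;> linarith, fun h hh => ?_, fun h hh => ?_⟩
      · by_cases hℓ : h < ℓ
        · have := hmax h ⟨hh, hℓ⟩
          rw [abs_sub_comm, abs_of_nonneg (by linarith)]
          linarith
        · push Not at hℓ
          rw [abs_of_nonneg (by linarith)]
          linarith
      · constructor
        · intro h1; linarith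
        · intro h2; have := hmax h ⟨hh, h2⟩; linarith
    · push Not at hcase
      refine ⟨a₀ + a / 8, by rw [abs_le]; constructor <;> linarith, fun h hh => ?_, fun h hh => ?_⟩
      · by_cases hℓ : h < ℓ
        · have := hmax h ⟨hh, hℓ⟩
          rw [abs_sub_comm, abs_of_nonneg (by linarith)]
          linarith
        · push Not at hℓ
          have hs := hsep a₀ ha₀H h hh (by linarith)
          rw [abs_of_nonneg (by linarith)]
          linarith
      · constructor
        · intro h1
          by_contra h2
          push Not at h2
          have hs := hsep a₀ ha₀H h hh (by linarith)
          linarith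
        · intro h2; have := hmax h ⟨hh, h2⟩; linarith
  · push Not at hB
    refine ⟨ℓ - a / 8, by rw [abs_le]; constructor <;> linarith, fun h hh => ?_, fun h hh => ?_⟩
    · have := hB h hh
      rw [abs_of_nonneg (by linarith)]
      linarith
    · constructor
      · intro h1; linarith
      · intro h2; exact absurd (hB h hh) (not_le.mpr h2)

/-- The bottom height `𝓛₁⁻`: the mirror image of `exists_top_height` (a height is above `Lm` iff it
is above `ℓ`). [cite: Zhang2022LandauSiegel, §8 p. 42, tex L2197–L2201] -/
theorem exists_bottom_height {H : Set ℝ} (hH : H.Finite) {a : ℝ} (ℓ : ℝ) (ha : 0 < a)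
    (hsep : ∀ h ∈ H, ∀ h' ∈ H, h < h' → a / 2 < h' - h) :
    ∃ Lm : ℝ, |Lm - ℓ| ≤ a / 8 ∧ (∀ h ∈ H, a / 8 ≤ |h - Lm|) ∧ ∀ h ∈ H, Lm < h ↔ ℓ < h := by
  have hH' : ((fun h : ℝ => -h) '' H).Finite := hH.image _
  have hsep' : ∀ h ∈ (fun h : ℝ => -h) '' H, ∀ h' ∈ (fun h : ℝ => -h) '' H,
      h < h' → a / 2 < h' - h := by
    rintro _ ⟨h, hh, rfl⟩ _ ⟨h', hh', rfl⟩ hlt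
    have := hsep h' hh' h hh (by linarith)
    linarith
  obtain ⟨Lp, h1, h2, h3⟩ := exists_top_height hH' (-ℓ) ha hsep'
  refine ⟨-Lp, by rw [show -Lp - ℓ = -(Lp - -ℓ) by ring, abs_neg]; exact h1, fun h hh => ?_,
    fun h hh => ?_⟩
  · have := h2 (-h) ⟨h, hh, rfl⟩
    rwa [show -h - Lp = -(h - -Lp) by ring, abs_neg] at this
  · have := h3 (-h) ⟨h, hh, rfl⟩
    constructor
    · intro hl; have := this.mp (by linarith); linarith
    · intro hl; have := this.mpr (by linarith); linarith

/-! ## The admissible rectangle at one character -/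

section Setting

variable {D : ℕ} [NeZero D] (χ : DirichletCharacter ℂ D)

/-- **`Z22:§8.u003` at one character, from Proposition 2.2 at that character** (p. 42): for
`D ≥ 3`, `χ` primitive, `c′ ≥ 0` with `5c′α𝓛 < 1` and `α ≤ 1/8`, if the zeros of `L(s,ψ)L(s,ψχ)` in
`Ω` lie on the critical line ((i)) and have consecutive gaps within `c′α²𝓛` of `α` ((iii)), then there
are heights `𝓛₁⁻, 𝓛₁⁺` with `AdmRect D x 1 (1/8) 𝓛₁⁻ 𝓛₁⁺`.
[cite: Zhang2022LandauSiegel, §8 p. 42, tex L2197–L2201] -/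
theorem admRect_of_prop22_at (hD : 3 ≤ D) (hχ : χ.IsPrimitive) {c' : ℝ} (hc' : 0 ≤ c')
    (hsmall : 5 * c' * alpha D * ell D < 1) (hα8 : alpha D ≤ 1 / 8) (x : Chr D)
    (h_i : ∀ s ∈ prodZeroSetOmega χ x, s.re = 1 / 2)
    (h_iii : ∀ s ∈ prodZeroSetOmega χ x, ∀ s' ∈ prodZeroSetOmega χ x, s.im < s'.im →
      (∀ s'' ∈ prodZeroSetOmega χ x, ¬ (s.im < s''.im ∧ s''.im < s'.im)) →
        |s'.im - s.im - alpha D| < c' * alpha D ^ 2 * ell D) :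
    ∃ Lm Lp : ℝ, AdmRect D x 1 (1 / 8) Lm Lp := by
  -- parameters
  have hα : 0 < alpha D := by
    rw [alpha, bigP, Real.log_exp]
    exact div_pos Real.pi_pos (pow_pos (by linarith [one_lt_ell hD]) _)
  have hℓ : 1 < ell D := one_lt_ell hD
  have he : 0 ≤ c' * alpha D ^ 2 * ell D := by positivity
  have heα : c' * alpha D ^ 2 * ell D ≤ alpha D / 2 := by
    have : c' * alpha D ^ 2 * ell D = alpha D * (c' * alpha D * ell D) := by ring
    rw [this]; nlinarith
  -- the heights of the zeros of `L(s,ψ)L(s,ψχ)` in `Ω`, a finite set, pairwise `> α/2` apart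
  set S : Set ℂ := prodZeroSetOmega χ x with hS_def
  have hSfin : S.Finite := prodZeroSetOmega_finite χ hD hχ x
  set H : Set ℝ := (fun s : ℂ => s.im - 2 * π * t0 D) '' S with hH_def
  have hHfin : H.Finite := hSfin.image _
  have hsep : ∀ h ∈ H, ∀ h' ∈ H, h < h' → alpha D / 2 < h' - h := by
    rintro _ ⟨s, hs, rfl⟩ _ ⟨s', hs', rfl⟩ hlt
    have h := im_gt_of_gap hSfin h_iii hs hs' (by linarith)
    linarith
  obtain ⟨Lp, hLp1, hLp2, hLp3⟩ := exists_top_height hHfin (ell1 D) hα hsep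
  obtain ⟨Lm, hLm1, hLm2, hLm3⟩ := exists_bottom_height hHfin (-ell1 D) hα hsep
  refine ⟨Lm, Lp, ?_, ?_, ?_, ?_⟩
  · -- `|𝓛₁⁺ − 𝓛₁| ≤ α`
    linarith [abs_nonneg (Lp - ell1 D)]
  · -- `|𝓛₁⁻ + 𝓛₁| ≤ α`
    rw [show Lm + ell1 D = Lm - -ell1 D by ring]
    linarith [abs_nonneg (Lm - -ell1 D)]
  · -- the zeros of `L(s,ψ)` inside `ℜ` are exactly `𝒵(ψ)`
    ext ρ
    simp only [Set.mem_setOf_eq, rectR, zeroSet]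
    constructor
    · rintro ⟨hL, hre, hlo, hhi⟩
      have hΩ : ρ ∈ Omega D := by
        refine ⟨?_, ?_⟩
        · rw [Complex.sub_re, s0_re]; linarith [abs_nonneg (ρ.re - 1 / 2)]
        · rw [Complex.sub_im, s0_im, abs_lt]
          have h1 := abs_le.mp hLp1
          have h2 := abs_le.mp hLm1
          constructor <;> linarith
      have hρS : ρ ∈ S := ⟨hΩ, by rw [hL, zero_mul]⟩
      have hh : ρ.im - 2 * π * t0 D ∈ H := ⟨ρ, hρS, rfl⟩
      have htop := (hLp3 _ hh).mp (by linarith)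
      have hbot := (hLm3 _ hh).mp (by linarith)
      refine ⟨lt_of_le_of_lt hre.le (by linarith), ?_, hL⟩
      rw [abs_lt]; constructor <;> linarith
    · rintro ⟨hre, him, hL⟩
      have hρS : ρ ∈ S := mem_prodZeroSetOmega_of_mem_zeroSet χ ⟨hre, him, hL⟩
      have hre' : ρ.re = 1 / 2 := h_i ρ hρS
      have hh : ρ.im - 2 * π * t0 D ∈ H := ⟨ρ, hρS, rfl⟩
      have him' := abs_lt.mp him
      have htop := (hLp3 _ hh).mpr (by linarith)
      have hbot := (hLm3 _ hh).mpr (by linarith)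
      refine ⟨hL, by rw [hre', sub_self, abs_zero]; exact hα, by linarith, by linarith⟩
  · -- every zero of `L(s,ψ)` is at distance `≥ α/8` from `∂ℜ`
    intro s hs ρ hL
    obtain ⟨⟨hsre, hslo, hshi⟩, hsnot⟩ := hs
    have hre_le : |(s - ρ).re| ≤ ‖s - ρ‖ := Complex.abs_re_le_norm _
    have him_le : |(s - ρ).im| ≤ ‖s - ρ‖ := Complex.abs_im_le_norm _
    rw [Complex.sub_re] at hre_le
    rw [Complex.sub_im] at him_le
    by_cases hbox : |ρ.re - 1 / 2| < 1 / 2 ∧ |ρ.im - 2 * π * t0 D| < ell1 D + 2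
    · -- `ρ ∈ Ω`: on the critical line, height in `H`
      have hΩ : ρ ∈ Omega D := by
        refine ⟨?_, ?_⟩
        · rw [Complex.sub_re, s0_re]; exact hbox.1
        · rw [Complex.sub_im, s0_im]; exact hbox.2
      have hρS : ρ ∈ S := ⟨hΩ, by rw [hL, zero_mul]⟩
      have hre' : ρ.re = 1 / 2 := h_i ρ hρS
      have hh : ρ.im - 2 * π * t0 D ∈ H := ⟨ρ, hρS, rfl⟩
      by_cases hvert : |s.re - 1 / 2| = alpha D
      · -- on a vertical edge: horizontal distance `α`
        have : alpha D ≤ |s.re - ρ.re| := by rw [hre', hvert]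
        linarith
      · -- on a horizontal edge: vertical distance `≥ α/8` by the choice of the heights
        have hlt : |s.re - 1 / 2| < alpha D := lt_of_le_of_ne hsre hvert
        have hedge : s.im = 2 * π * t0 D + Lp ∨ s.im = 2 * π * t0 D + Lm := by
          by_contra hne
          push Not at hne
          apply hsnot
          exact ⟨hlt, lt_of_le_of_ne hslo (fun h => hne.2 h.symm), lt_of_le_of_ne hshi hne.1⟩
        rcases hedge with hsim | hsim
        · have h2 := hLp2 _ hh
          rw [show ρ.im - 2 * π * t0 D - Lp = -(s.im - ρ.im) by rw [hsim]; ring, abs_neg] at h2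
          linarith
        · have h2 := hLm2 _ hh
          rw [show ρ.im - 2 * π * t0 D - Lm = -(s.im - ρ.im) by rw [hsim]; ring, abs_neg] at h2
          linarith
    · -- `ρ ∉ Ω`: far from the rectangle
      rw [not_and_or, not_lt, not_lt] at hbox
      rcases hbox with hfar | hfar
      · -- `|Re ρ − ½| ≥ ½` while `|Re s − ½| ≤ α ≤ 1/8`
        have h1 : 1 / 2 - alpha D ≤ |s.re - ρ.re| := by
          have := abs_sub_abs_le_abs_sub (ρ.re - 1 / 2) (s.re - 1 / 2)
          rw [show ρ.re - 1 / 2 - (s.re - 1 / 2) = -(s.re - ρ.re) by ring, abs_neg] at this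
          linarith
        linarith
      · -- `|Im ρ − 2πt₀| ≥ 𝓛₁ + 2` while `Im s` is within `𝓛₁ + α/8` of `2πt₀`
        have hLp := abs_le.mp hLp1
        have hLm := abs_le.mp hLm1
        have h1 : ell1 D + 2 - (ell1 D + alpha D / 8) ≤ |s.im - ρ.im| := by
          have := abs_sub_abs_le_abs_sub (ρ.im - 2 * π * t0 D) (s.im - 2 * π * t0 D)
          rw [show ρ.im - 2 * π * t0 D - (s.im - 2 * π * t0 D) = -(s.im - ρ.im) by ring,
            abs_neg] at this
          have h3 : |s.im - 2 * π * t0 D| ≤ ell1 D + alpha D / 8 := by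
            rw [abs_le]; constructor <;> linarith
          linarith
        linarith

end Setting

/-! ## `Z22:§8.u003` from Proposition 2.2, for all large `D` -/

/-- `L₀ ≤ log D` once `D ≥ ⌈exp L₀⌉₊`. [folklore] -/
private theorem u003_threshold_le_ell {L₀ : ℝ} {D : ℕ} (hD : ⌈Real.exp L₀⌉₊ ≤ D) : L₀ ≤ ell D := by
  have h : Real.exp L₀ ≤ D := le_trans (Nat.le_ceil _) (by exact_mod_cast hD)
  exact (Real.le_log_iff_exp_le (lt_of_lt_of_le (Real.exp_pos _) h)).mpr h

/-- The thresholds: `𝓛 ≥ max(2, 5πc′+1)` gives `5c′α𝓛 < 1` and `α ≤ 1/8` (`α = π/𝓛⁹ ≤ π/512`).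
[cite: Zhang2022LandauSiegel, §2 (2.10)] -/
private theorem u003_alpha_small {c' : ℝ} {D : ℕ} (hℓ2 : 2 ≤ ell D) (hℓc : 5 * π * c' + 1 ≤ ell D) :
    5 * c' * alpha D * ell D < 1 ∧ alpha D ≤ 1 / 8 := by
  have hα : alpha D = π / ell D ^ 9 := by rw [alpha, bigP, Real.log_exp]
  have hℓ9 : (512 : ℝ) ≤ ell D ^ 9 := by
    calc (512 : ℝ) = 2 ^ 9 := by norm_num
      _ ≤ ell D ^ 9 := by gcongr
  refine ⟨?_, ?_⟩
  · have h8 : ell D ≤ ell D ^ 8 := le_self_pow₀ (by linarith) (by norm_num)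
    have hkey : 5 * c' * π * ell D < ell D ^ 9 := by
      have h9 : ell D ^ 9 = ell D ^ 8 * ell D := by ring
      rw [h9]
      have : 5 * π * c' < ell D ^ 8 := by linarith
      nlinarith
    rw [hα]
    calc 5 * c' * (π / ell D ^ 9) * ell D = 5 * c' * π * ell D / ell D ^ 9 := by ring
      _ < 1 := by rw [div_lt_one (by positivity)]; exact hkey
  · rw [hα, div_le_iff₀ (by positivity)]
    nlinarith [Real.pi_lt_four]

/-- **`Z22:§8.u003` HOLDS given Proposition 2.2**: "By Proposition 2.2, we can choose a rectangle
`ℜ` with vertices at `s₀ ± α + i𝓛₁^{±}` such that `𝓛₁^{±} = ±𝓛₁ + O(α)` and such that the set of zeros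
of `L(s,ψ)` inside `ℜ` is exactly `𝒵(ψ)` … `|s − ρ| ≫ α` if `s ∈ ∂ℜ`" (p. 42) — for every `c′ ≥ 0`,
`Skeleton.Prop22 c′` gives `Section8aStatements.Step8u003` with `C = 1`, `c₀ = 1/8`, for all `D`
with `𝓛 ≥ max(2, 5πc′+1)` beyond Proposition 2.2's own threshold.
[cite: Zhang2022LandauSiegel, §8 p. 42, tex L2197–L2201] -/
theorem step8u003_of_prop22 {c' : ℝ} (hc' : 0 ≤ c') (h22 : Skeleton.Prop22 c') : Step8u003 := by
  obtain ⟨h_i, -, h_iii⟩ := h22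
  obtain ⟨D₁, h⟩ := h_i.and h_iii
  refine ⟨1, 1 / 8, by norm_num, max (max D₁ 3) ⌈Real.exp (max 2 (5 * π * c' + 1))⌉₊,
    fun D _ χ hD hq hp _ x hx => ?_⟩
  have hD₁ : D₁ ≤ D := le_trans (le_trans (le_max_left _ _) (le_max_left _ _)) hD
  have hD3 : 3 ≤ D := le_trans (le_trans (le_max_right _ _) (le_max_left _ _)) hD
  have hL := u003_threshold_le_ell (le_trans (le_max_right _ _) hD)
  obtain ⟨hsmall, hα8⟩ := u003_alpha_small (le_trans (le_max_left _ _) hL)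
    (le_trans (le_max_right _ _) hL)
  obtain ⟨e_i, e_iii⟩ := h D χ hD₁ hq hp
  exact admRect_of_prop22_at χ hD3 hp hc' hsmall hα8 x (e_i x hx) (e_iii x hx)

end Literature.NumberTheory.LFunctions.Zhang2022.Section8aStatements
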